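/-
Copyright (c) 2026 the pub-hodgecm-mathlib formalisation cell (harness21).  Prover seat hodgecm-mathlib-K2Liu-p12 (g2): Track B «K2-LIT»,
#184♮ = hLiu418 = stmt-HodgeConjecture-24832; Road Φ of socket #41, organ Φ4-EXACT (LEAD F0P6-plan ruling «M-157p»), file E2a.
-/
import Summits.HodgeConjecture.HodgeConjecture.Theorems.K2LiuWhittakerCharacterMoves        -- ★ F3c-2: `map_conj_eq_of_skew`, `tau_trace_linear_term`, `mball_of_forall_coeff_mem`
import Summits.HodgeConjecture.HodgeConjecture.Theorems.K2LiuWhittakerContentStrata          -- ★ E1b (hence E1a): `det_mem_ball_two`, `valued_eq_zpow_of_le_of_not_le`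
import Literature.NumberTheory.GelbartRogawski1991.LocalDoubledUnitaryBigCellValue            -- ★ `gramS_map_conj`, `gramS_transpose`
import HarnessLib

/-!
# Crux `HLiu418`, Road Φ of socket #41, organ Φ4-EXACT — FILE E2a: SKEW ALGEBRA FOR THE TRACE PAIRING ON THE SKEW LATTICE

Cell `hodgecm-mathlib`, crux item hLiu418 = `stmt-HodgeConjecture-24832`, route of record `HCCMUnconditional`; squad K2 ∕ K2Liu, road `K2_Liu`,
socket #41 `sig_K2LiuSiegelEisensteinContinuation`, Road Φ, organ Φ4-EXACT (ruling M-157p; method memo `K2/K2Liu-p12/g2/CENSUS-PHI4-EXACT-Method.K2Liu-p12-g2.md`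
§1 (c)).  THEOREMS ONLY (no `def`, no `instance`, no `notation`, no named-fact hypothesis, no `sorry`); lane `--supports stmt-HodgeConjecture-24832`
(count-neutral helper; closes no socket by itself).

THE OBJECTS.  `R = E ⊗ F_v`, `σ = conjLocal`, `T = gramS` (σ-fixed, symmetric, invertible), the `T`-skew lattice `S = {X : σ(X)ᵀ T + T X = 0}`, balls
`ball a` in the letter of ★ F3c-1, `τ : R → F_v` with `ι(τ r) = r + σ r` (hypothesis-first), the Whittaker character `χ_β(Z) = ψ_v(−τ tr(β Z))` for a
UNIMODULAR `T`-skew `β` (`β β⁻ = 1`, `β, β⁻` integral), `ψ_v` of conductor exponent `0`, and an anti-invariant unit `ε` (`σε = −ε`, `|2ε|_w = 1`: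
the place is unramified).
* §1 SKEW ALGEBRA: the projector `Y ↦ Y + Y°`, `Y° := −T⁻¹ σ(Y)ᵀ T`, lands in `S`; `tr(t Y°) = σ(tr(t Y))` for `t ∈ S`, so `τ tr(t(Y + Y°)) = 2 τ tr(t Y)`;
  `S` is stable under `ι(F_v)`-scalars, under `X ↦ X⁻¹` (`β⁻ ∈ S`) and, for `2 × 2`, under the adjugate.
* `2 × 2` ALGEBRA: `adj X = tr X·1 − X` is `T`-skew for `T`-skew `X`; `det(A + B) = det A + tr(adj A·B) + det B`; `adj X ∈ ball a` for `X ∈ ball a`.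
These are the algebraic inputs of the PERFECTNESS of the trace pairing on `S ∩ ball 0` and of the NON-TRIVIALITY of `χ_β` on the fibres of the det
level sets (file E2b), hence of the vanishing of the lattice integrals `I(k,m)`, `(k,m) ≠ (1,1)` (file E2c).

## References
* [Shimura1997] G. Shimura, *Euler Products and Eisenstein Series*, CBMS 93 (1997), §13.5–13.6, §18.
* [KudlaRallis1994] S. Kudla, S. Rallis, Ann. of Math. 140 (1994), §2.   * [Casselman1980] W. Casselman, Compositio Math. 40 (1980), §3.
* [Tate1950] J. Tate, thesis (1950), §2.2–2.5.
-/

set_option autoImplicit false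
-- the mandated namespace repeats the single-problem summit's segment (`HodgeConjecture.HodgeConjecture`)
set_option linter.dupNamespace false

noncomputable section

open scoped Matrix
open NumberField IsDedekindDomain Matrix
open Literature.NumberTheory.Automorphic Literature.NumberTheory.Automorphic.UnitaryGroup
open Literature.NumberTheory.GelbartRogawski1991.UnitaryDualPair.LocalSplitting
open Summit.HodgeConjecture.HodgeConjecture.Cruxes.HLiu418.K2LiuLocalRingValuationBalls
open Summit.HodgeConjecture.HodgeConjecture.Cruxes.HLiu418.K2LiuWhittakerCharacterMoves
open Summit.HodgeConjecture.HodgeConjecture.Cruxes.HLiu418.K2LiuWhittakerContentProfile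
open Summit.HodgeConjecture.HodgeConjecture.Cruxes.HLiu418.K2LiuWhittakerContentStrata

namespace Summit.HodgeConjecture.HodgeConjecture.Cruxes.HLiu418.K2LiuSkewPairingNondegeneracy

variable (F : Type) [Field F] [NumberField F] (E : Type) [Field E] [NumberField E] [Algebra F E]
  [Algebra.IsQuadraticExtension F E] (c : E ≃ₐ[F] E) {δ : E} (hcδ : c δ = -δ) (hδ : δ ≠ 0)
  (v : HeightOneSpectrum (𝓞 F)) {π : v.adicCompletion F} (hπ : Valued.v π = WithZero.exp (-1 : ℤ))
  {n : ℕ} {T₀ : Matrix (Fin n) (Fin n) F} (hT₀ : T₀.IsSymm) (hT₀d : IsUnit T₀.det)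

/-! ## §1 Skew algebra: the projector `Y ↦ Y + Y°`, scalars, inverses, adjugates -/

include hcδ hδ hT₀ hT₀d in
/-- **the projector onto `S`**: `Y + Y° ∈ S` with `Y° = −T⁻¹ σ(Y)ᵀ T`, for every matrix `Y`. [cite: Shimura1997, §13.5] -/
theorem add_dual_skew (Y : Matrix (Fin n) (Fin n) (LocalRing E v)) :
    ((Y + -((gramS F E v n T₀)⁻¹ * (Y.map (conjLocal E c v))ᵀ * gramS F E v n T₀)).map (conjLocal E c v))ᵀ * gramS F E v n T₀ +
      gramS F E v n T₀ * (Y + -((gramS F E v n T₀)⁻¹ * (Y.map (conjLocal E c v))ᵀ * gramS F E v n T₀)) = 0 := by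
  set T := gramS F E v n T₀ with hTdef
  have hT : IsUnit T.det := isUnit_det_gramS' F E v n hT₀d
  have hTσ : T.map (conjLocal E c v) = T := gramS_map_conj F E c v n
  have hTt : Tᵀ = T := gramS_transpose F E v n hT₀
  -- `σ(T⁻¹) = T⁻¹`
  have hTiσ : T⁻¹.map (conjLocal E c v) = T⁻¹ := by
    have h1 : T⁻¹.map (conjLocal E c v) * T = 1 := by
      calc T⁻¹.map (conjLocal E c v) * T = T⁻¹.map (conjLocal E c v) * T.map (conjLocal E c v) := by rw [hTσ]
        _ = (T⁻¹ * T).map (conjLocal E c v) := Matrix.map_mul.symm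
        _ = 1 := by rw [Matrix.nonsing_inv_mul _ hT, Matrix.map_one _ (map_zero _) (map_one _)]
    rw [← Matrix.inv_eq_left_inv h1]
  have hYσσ : (Y.map (conjLocal E c v)).map (conjLocal E c v) = Y := by
    ext i j; simp only [Matrix.map_apply, UnitaryGroup.conjLocal_conjLocal c v hcδ hδ]
  -- `σ(Y°)ᵀ = −T Y T⁻¹`
  have hdual : ((-(T⁻¹ * (Y.map (conjLocal E c v))ᵀ * T)).map (conjLocal E c v))ᵀ = -(T * Y * T⁻¹) := by
    rw [Matrix.map_neg _ (map_neg _), Matrix.transpose_neg, Matrix.map_mul, Matrix.map_mul, hTiσ, hTσ,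
      Matrix.transpose_map, hYσσ, Matrix.transpose_mul, Matrix.transpose_mul, Matrix.transpose_transpose,
      Matrix.transpose_nonsing_inv, hTt, Matrix.mul_assoc]
  rw [Matrix.map_add _ (map_add _), Matrix.transpose_add, hdual, Matrix.add_mul, Matrix.mul_add, Matrix.neg_mul, Matrix.mul_neg,
    Matrix.nonsing_inv_mul_cancel_right _ _ hT, ← Matrix.mul_assoc, ← Matrix.mul_assoc, Matrix.mul_nonsing_inv _ hT, Matrix.one_mul]
  abel

include hT₀ hT₀d in
omit [Algebra.IsQuadraticExtension F E] in
/-- **the trace pairing with the dual**: for `t ∈ S`, `tr(t · Y°) = σ(tr(t Y))`, `Y° = −T⁻¹σ(Y)ᵀT`. [cite: Shimura1997, §13.5] [cite: KudlaRallis1994, §2] -/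
theorem trace_mul_dual_eq_conj {t : Matrix (Fin n) (Fin n) (LocalRing E v)}
    (ht : (t.map (conjLocal E c v))ᵀ * gramS F E v n T₀ + gramS F E v n T₀ * t = 0) (Y : Matrix (Fin n) (Fin n) (LocalRing E v)) :
    Matrix.trace (t * -((gramS F E v n T₀)⁻¹ * (Y.map (conjLocal E c v))ᵀ * gramS F E v n T₀)) = conjLocal E c v (Matrix.trace (t * Y)) := by
  set T := gramS F E v n T₀ with hTdef
  have hT : IsUnit T.det := isUnit_det_gramS' F E v n hT₀d
  have hTt : Tᵀ = T := gramS_transpose F E v n hT₀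
  have hσt := map_conj_eq_of_skew F E c v hT hTt ht
  rw [show conjLocal E c v (Matrix.trace (t * Y)) = Matrix.trace ((t * Y).map (conjLocal E c v)) from
      AddMonoidHom.map_trace (conjLocal E c v : LocalRing E v →+* LocalRing E v) _, Matrix.map_mul, hσt]
  -- both sides equal `−tr(T⁻¹ tᵀ T σY)`
  rw [Matrix.mul_neg, Matrix.trace_neg, Matrix.neg_mul, Matrix.trace_neg, neg_inj]
  calc Matrix.trace (t * (T⁻¹ * (Y.map (conjLocal E c v))ᵀ * T))
      = Matrix.trace ((t * (T⁻¹ * (Y.map (conjLocal E c v))ᵀ * T))ᵀ) := (Matrix.trace_transpose _).symm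
    _ = Matrix.trace (T * Y.map (conjLocal E c v) * T⁻¹ * tᵀ) := by
        rw [Matrix.transpose_mul, Matrix.transpose_mul, Matrix.transpose_mul, Matrix.transpose_transpose, Matrix.transpose_nonsing_inv, hTt]
        simp only [Matrix.mul_assoc]
    _ = Matrix.trace (T⁻¹ * tᵀ * T * Y.map (conjLocal E c v)) := by
        rw [Matrix.trace_mul_cycle (T * Y.map (conjLocal E c v)) T⁻¹ tᵀ, Matrix.trace_mul_cycle tᵀ (T * Y.map (conjLocal E c v)) T⁻¹]
        simp only [Matrix.mul_assoc]

include hcδ hδ hT₀ hT₀d in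
/-- **`τ tr(t(Y + Y°)) = 2 τ tr(tY)`** for `t ∈ S` (`τ ∘ σ = τ`). [cite: Shimura1997, §13.5] -/
theorem tau_trace_mul_add_dual {τ : LocalRing E v → v.adicCompletion F} (hτ : ∀ r, toLocalRing E v (τ r) = r + conjLocal E c v r)
    (hτadd : ∀ r s, τ (r + s) = τ r + τ s) {t : Matrix (Fin n) (Fin n) (LocalRing E v)}
    (ht : (t.map (conjLocal E c v))ᵀ * gramS F E v n T₀ + gramS F E v n T₀ * t = 0) (Y : Matrix (Fin n) (Fin n) (LocalRing E v)) :
    τ (Matrix.trace (t * (Y + -((gramS F E v n T₀)⁻¹ * (Y.map (conjLocal E c v))ᵀ * gramS F E v n T₀)))) =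
      τ (Matrix.trace (t * Y)) + τ (Matrix.trace (t * Y)) := by
  rw [Matrix.mul_add, Matrix.trace_add, hτadd, trace_mul_dual_eq_conj F E c v hT₀ hT₀d ht Y, tau_conjLocal F E c v hcδ hδ hτ]

omit [Algebra.IsQuadraticExtension F E] in
/-- `S` is stable under the scalars `ι(F_v)`. [folklore] -/
theorem smul_skew (a : v.adicCompletion F) {X : Matrix (Fin n) (Fin n) (LocalRing E v)}
    (hX : (X.map (conjLocal E c v))ᵀ * gramS F E v n T₀ + gramS F E v n T₀ * X = 0) :
    ((toLocalRing E v a • X).map (conjLocal E c v))ᵀ * gramS F E v n T₀ + gramS F E v n T₀ * (toLocalRing E v a • X) = 0 := by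
  have hmap : (toLocalRing E v a • X).map (conjLocal E c v) = toLocalRing E v a • X.map (conjLocal E c v) := by
    ext i j; simp only [Matrix.map_apply, Matrix.smul_apply, smul_eq_mul, map_mul, conjLocal_toLocalRing]
  rw [hmap, Matrix.transpose_smul, Matrix.smul_mul, Matrix.mul_smul, ← smul_add, hX, smul_zero]

omit [Algebra.IsQuadraticExtension F E] in
/-- **the inverse of a unimodular `T`-skew element is `T`-skew** (`β β⁻ = 1`). [folklore] -/
theorem inv_skew {β βinv : Matrix (Fin n) (Fin n) (LocalRing E v)}
    (hβ : (β.map (conjLocal E c v))ᵀ * gramS F E v n T₀ + gramS F E v n T₀ * β = 0) (hββ : β * βinv = 1) :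
    (βinv.map (conjLocal E c v))ᵀ * gramS F E v n T₀ + gramS F E v n T₀ * βinv = 0 := by
  set T := gramS F E v n T₀
  have h1 : (βinv.map (conjLocal E c v))ᵀ * (β.map (conjLocal E c v))ᵀ = 1 := by
    rw [← Matrix.transpose_mul, ← Matrix.map_mul, hββ, Matrix.map_one _ (map_zero _) (map_one _), Matrix.transpose_one]
  have h2 : (β.map (conjLocal E c v))ᵀ * T = -(T * β) := eq_neg_of_add_eq_zero_left hβ
  calc (βinv.map (conjLocal E c v))ᵀ * T + T * βinv
      = (βinv.map (conjLocal E c v))ᵀ * (T * (β * βinv)) + T * βinv := by rw [hββ, Matrix.mul_one]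
    _ = (βinv.map (conjLocal E c v))ᵀ * (T * β) * βinv + T * βinv := by simp only [Matrix.mul_assoc]
    _ = -((βinv.map (conjLocal E c v))ᵀ * (β.map (conjLocal E c v))ᵀ) * T * βinv + T * βinv := by
        rw [show T * β = -((β.map (conjLocal E c v))ᵀ * T) by rw [h2, neg_neg]]
        simp only [Matrix.mul_neg, Matrix.neg_mul, Matrix.mul_assoc]
    _ = 0 := by rw [h1, Matrix.neg_mul, Matrix.neg_mul, Matrix.one_mul, neg_add_cancel]

include hT₀d in
omit [Algebra.IsQuadraticExtension F E] in
/-- a `T`-skew `Y` is its own dual: `Y° = Y`. [cite: Shimura1997, §13.5] -/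
theorem dual_eq_self_of_skew {Y : Matrix (Fin n) (Fin n) (LocalRing E v)}
    (hY : (Y.map (conjLocal E c v))ᵀ * gramS F E v n T₀ + gramS F E v n T₀ * Y = 0) :
    -((gramS F E v n T₀)⁻¹ * (Y.map (conjLocal E c v))ᵀ * gramS F E v n T₀) = Y := by
  have hT : IsUnit (gramS F E v n T₀).det := isUnit_det_gramS' F E v n hT₀d
  have h2 : (Y.map (conjLocal E c v))ᵀ * gramS F E v n T₀ = -(gramS F E v n T₀ * Y) := eq_neg_of_add_eq_zero_left hY
  rw [Matrix.mul_assoc, h2, Matrix.mul_neg, neg_neg, Matrix.nonsing_inv_mul_cancel_left _ _ hT]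

include hT₀ hT₀d in
omit [Algebra.IsQuadraticExtension F E] in
/-- **the pairing of two `T`-skew matrices is `σ`-fixed**: `σ(tr(W Y)) = tr(W Y)`. [cite: Shimura1997, §13.5] -/
theorem conj_trace_mul_of_skew {W Y : Matrix (Fin n) (Fin n) (LocalRing E v)}
    (hW : (W.map (conjLocal E c v))ᵀ * gramS F E v n T₀ + gramS F E v n T₀ * W = 0)
    (hY : (Y.map (conjLocal E c v))ᵀ * gramS F E v n T₀ + gramS F E v n T₀ * Y = 0) :
    conjLocal E c v (Matrix.trace (W * Y)) = Matrix.trace (W * Y) := by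
  rw [← trace_mul_dual_eq_conj F E c v hT₀ hT₀d hW Y, dual_eq_self_of_skew F E c v hT₀d hY]

include hT₀ hT₀d in
omit [Algebra.IsQuadraticExtension F E] in
/-- `σ(tr X) = −tr X` for a `T`-skew `X`. [cite: Shimura1997, §13.5] -/
theorem conj_trace_of_skew {X : Matrix (Fin n) (Fin n) (LocalRing E v)}
    (hX : (X.map (conjLocal E c v))ᵀ * gramS F E v n T₀ + gramS F E v n T₀ * X = 0) :
    conjLocal E c v (Matrix.trace X) = -Matrix.trace X := by
  have hT : IsUnit (gramS F E v n T₀).det := isUnit_det_gramS' F E v n hT₀d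
  rw [show conjLocal E c v (Matrix.trace X) = Matrix.trace (X.map (conjLocal E c v)) from
      AddMonoidHom.map_trace (conjLocal E c v : LocalRing E v →+* LocalRing E v) _,
    map_conj_eq_of_skew F E c v hT (gramS_transpose F E v n hT₀) hX, Matrix.trace_neg, Matrix.trace_mul_cycle, Matrix.mul_nonsing_inv _ hT,
    Matrix.one_mul, Matrix.trace_transpose]

omit [Algebra.IsQuadraticExtension F E] in
/-- `c • 1 − X` is `T`-skew when `X` is and `σ c = −c`. [folklore] -/
theorem smul_one_sub_skew {cc : LocalRing E v} (hcc : conjLocal E c v cc = -cc) {X : Matrix (Fin n) (Fin n) (LocalRing E v)}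
    (hX : (X.map (conjLocal E c v))ᵀ * gramS F E v n T₀ + gramS F E v n T₀ * X = 0) :
    ((cc • (1 : Matrix (Fin n) (Fin n) (LocalRing E v)) - X).map (conjLocal E c v))ᵀ * gramS F E v n T₀ +
      gramS F E v n T₀ * (cc • (1 : Matrix (Fin n) (Fin n) (LocalRing E v)) - X) = 0 := by
  have hmap : (cc • (1 : Matrix (Fin n) (Fin n) (LocalRing E v))).map (conjLocal E c v) = (-cc) • (1 : Matrix (Fin n) (Fin n) (LocalRing E v)) := by
    ext i j
    simp only [Matrix.map_apply, Matrix.smul_apply, smul_eq_mul, map_mul, hcc, Matrix.one_apply]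
    split_ifs <;> simp
  rw [Matrix.map_sub _ (map_sub _), Matrix.transpose_sub, hmap, Matrix.transpose_smul, Matrix.transpose_one, Matrix.sub_mul, Matrix.mul_sub,
    Matrix.smul_mul, Matrix.mul_smul, Matrix.one_mul, Matrix.mul_one, eq_neg_of_add_eq_zero_left hX]
  simp only [neg_smul]
  abel

/-- `2 × 2`: `adj X = tr X · 1 − X`. [folklore] -/
theorem adjugate_eq_trace_smul_sub {R : Type*} [CommRing R] (X : Matrix (Fin 2) (Fin 2) R) :
    X.adjugate = Matrix.trace X • (1 : Matrix (Fin 2) (Fin 2) R) - X := by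
  rw [Matrix.adjugate_fin_two, Matrix.trace_fin_two]
  ext i j
  fin_cases i <;> fin_cases j <;> simp

/-- `2 × 2`: `det(A + B) = det A + tr(adj A · B) + det B`. [folklore] -/
theorem det_add_fin_two {R : Type*} [CommRing R] (A B : Matrix (Fin 2) (Fin 2) R) :
    (A + B).det = A.det + Matrix.trace (A.adjugate * B) + B.det := by
  simp only [Matrix.det_fin_two, Matrix.adjugate_fin_two, Matrix.trace_fin_two, Matrix.add_apply, Matrix.mul_apply, Fin.sum_univ_two,
    Matrix.of_apply, Matrix.cons_val', Matrix.cons_val_zero, Matrix.cons_val_one, Matrix.cons_val_fin_one, Matrix.empty_val']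
  ring

omit [Algebra.IsQuadraticExtension F E] in
/-- `2 × 2`: `X ∈ ball a ⇒ adj X ∈ ball a`. [folklore] -/
theorem mball_adjugate {a : ℤ} {X : Matrix (Fin 2) (Fin 2) (LocalRing E v)}
    (hX : ∀ i j (w : PlacesOver E v), Valued.v (X i j w) ≤ Valued.v (toPlace v w π) ^ a) :
    ∀ i j (w : PlacesOver E v), Valued.v (X.adjugate i j w) ≤ Valued.v (toPlace v w π) ^ a := by
  intro i j w
  rw [Matrix.adjugate_fin_two]
  fin_cases i <;> fin_cases j
  · simpa using hX 1 1 w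
  · simpa using hX 0 1 w
  · simpa using hX 1 0 w
  · simpa using hX 0 0 w

omit [Algebra.IsQuadraticExtension F E] in
/-- `2 × 2`: the adjugate of a `T`-skew matrix is `T`-skew. [folklore] -/
theorem adjugate_skew {T₀' : Matrix (Fin 2) (Fin 2) F} (hT₀' : T₀'.IsSymm) (hT₀d' : IsUnit T₀'.det) {X : Matrix (Fin 2) (Fin 2) (LocalRing E v)}
    (hX : (X.map (conjLocal E c v))ᵀ * gramS F E v 2 T₀' + gramS F E v 2 T₀' * X = 0) :
    (X.adjugate.map (conjLocal E c v))ᵀ * gramS F E v 2 T₀' + gramS F E v 2 T₀' * X.adjugate = 0 := by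
  rw [adjugate_eq_trace_smul_sub]
  exact smul_one_sub_skew F E c v (conj_trace_of_skew F E c v hT₀' hT₀d' hX) hX

omit [Algebra.IsQuadraticExtension F E] in
/-- differences of `T`-skew matrices are `T`-skew. [folklore] -/
theorem sub_skew {X Y : Matrix (Fin n) (Fin n) (LocalRing E v)}
    (hX : (X.map (conjLocal E c v))ᵀ * gramS F E v n T₀ + gramS F E v n T₀ * X = 0)
    (hY : (Y.map (conjLocal E c v))ᵀ * gramS F E v n T₀ + gramS F E v n T₀ * Y = 0) :
    ((X - Y).map (conjLocal E c v))ᵀ * gramS F E v n T₀ + gramS F E v n T₀ * (X - Y) = 0 := by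
  rw [Matrix.map_sub _ (map_sub _), Matrix.transpose_sub, Matrix.sub_mul, Matrix.mul_sub, sub_add_sub_comm, hX, hY, sub_zero]

end Summit.HodgeConjecture.HodgeConjecture.Cruxes.HLiu418.K2LiuSkewPairingNondegeneracy

end
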